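import Summits.ResolutionOfSingularities.ResolutionOfSingularities.Theorems.FrobeniusClosingPatchingRelPerfectDepthOneDictionaryStepPow
import HarnessLib

/-!
# Crux `PatchingRelPerfect` (stmt-ResolutionOfSingularities-16161), chain w52 — R4 support:
# the MIXED-WEIGHT dictionary step with MONOMIAL contact (`D1^{ℓ,ν}`)

[OURS · L1 W5.2 · rung tool] res-L1-w52-plan-1 g6, KERNEL NOTE v1.6 (STATUS 2026-08-27T05:26:19Z, with
`ChainW52TargetsF2.lean`): along an E-side weighted sequence (`IsWeightedSeq μ`, per-step weight
`1 ≤ ν_j ≤ μ`) the steps of weight `ν < ℓ` «degrade literal to MONOMIAL contact `N·𝓘_{E′}^ℓ ≤ K′` (`N` an snc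
exceptional monomial over the closed point)». This file proves the corresponding X-side dictionary step in the
HOST format of D1 / D_ℓ (`…DepthOneDictionaryStep.lean` p495681, `…DepthOneDictionaryStepPow.lean` p497259 —
same binder shape, so that the step composes with the existing towers and END lemmas), for an arbitrary
contact exponent `ℓ`, an arbitrary step weight `ν ≤ ℓ` and an arbitrary effective Cartier «monomial» `N`:
* `DepthOne.dictionaryStep_mixed` — `S` regular local, `i : E ⟶ X` a closed immersion of the regular `E`
  into the Noetherian regular `X` with `𝓘_E = i.ker` an effective Cartier divisor, `E` over the closed point,
  `g : X ⟶ Spec S` a blowing up cosupported in the closed point, FORMAT `I𝒪_X = M · K` with `M` effective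
  Cartier, MONOMIAL CONTACT `N · 𝓘_E^ℓ ≤ K` with `N` effective Cartier, `K|_E = 𝔟`; one step `τ : E' ⟶ E`
  blowing up a centre `C` with `V(C)` regular, of weight `ν ≤ ℓ`: `K ≤ (C.map i)^ν` and
  `𝔟𝒪_{E'} = (C𝒪_{E'})^ν · 𝔟'`. Then, with `σ : X' = Bl_{C.map i} X ⟶ X`, `i' = Bl(i)`, `M' = σ^*M · 𝓘_{exc}^ν`,
  `N' = σ^*N · 𝓘_{exc}^{ℓ-ν}`, `K' = (σ^*K : 𝓘_{exc}^ν)`, every invariant field is re-established: `X'` Noetherian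
  regular, `E'` regular, `i'` a closed immersion with `𝓘_{E'}` effective Cartier and `𝓘_{exc} · 𝓘_{E'} = σ^*𝓘_E`,
  `E' ↦ 𝔪`, `σ ≫ g` cosupported in `{𝔪}`, `M'` and `N'` effective Cartier, **`N' · 𝓘_{E'}^ℓ ≤ K'`**,
  `K'|_{E'} = 𝔟'`, `I𝒪_{X'} = M' · K'`. The one new line: cancel `𝓘_{exc}^ν` in
  `σ^*(N · 𝓘_E^ℓ) = σ^*N · 𝓘_{exc}^ℓ · 𝓘_{E'}^ℓ ≤ σ^*K = 𝓘_{exc}^ν · K'`.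
* `DepthOne.dictionaryStep_mixed_controlledTransform` — the same with the threefold side READ OFF:
  `𝔟 := K|_E`, `K'|_{E'} = controlledTransform τ C (K|_E) ν`.
* `DepthOne.dictionaryStep_mixed_one` — the WEIGHT-ONE step (`ν = 1`), where the X-side permissibility
  `K ≤ C.map i` FOLLOWS from the E-side one `K|_E ≤ C` (as in D1): no X-side hypothesis.
* `DepthOne.support_subset_of_mul_ker_pow_le_of_comap_eq_top` — the mixed END (unit branch): monomial
  contact `N · 𝓘_E^ℓ ≤ K` and `K|_E = ⊤` force `Supp K ⊆ Supp N` — the residual ESCAPES onto the monomial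
  (for `N = ⊤`: `K = ⊤`, the depth-`ℓ` END of `…DepthOneEndPow.lean`, p498490).
* `DepthOne.monomial_support_over_closedPoint` — bookkeeping: the new monomial `σ^*N · 𝓘_{exc}^k` stays
  cosupported over the closed point when `N` is (the escaped residual lives on exceptional carriers over `𝔪`).
Specialisations: `ν = ℓ`, `N = ⊤` is D_ℓ; `ℓ = ν = 1`, `N = ⊤` is D1; `ℓ = 2`, `ν = 1` is the step at an
order-one centre of the depth-two rung R4 (plan-1's W₂ Phase A with `ν_j = min(2, ord)`, and the order-one
residual phase driven by Θ₃). Fact-free. Nothing here is a statement of the manuscript under review.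

## References
* E. Bierstone, D. Grigoriev, P. Milman, J. Włodarczyk (2011), §3.2 Lemma 3.2.1 (controlled transform).
  [BierstoneGrigorievMilmanWlodarczyk2011]
* U. Görtz, T. Wedhorn, *Algebraic Geometry I* (2020), (13.19) p. 414, Prop. 13.91 (1), 13.96 (2). [GortzWedhorn2020]
* J. Kollár, *Lectures on Resolution of Singularities* (2007), (3.111) Step 3. [Kollar2007]
* Q. Liu (2002), Thm. 8.1.19 (a). [Liu2002]
-/

-- `Summit.<Summit>.<Sub>.Theorems` with `Sub = Summit` (single-conjunct summit, D-0017)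
set_option linter.dupNamespace false

noncomputable section

open CategoryTheory CategoryTheory.Limits AlgebraicGeometry TopologicalSpace
open Literature.AlgebraicGeometry.Resolution
open IsLocalRing

namespace Summit.ResolutionOfSingularities.ResolutionOfSingularities.Theorems

universe u

namespace DepthOne

/-- **D1^{ℓ,ν} — the dictionary step of weight `ν ≤ ℓ` with monomial contact `N · 𝓘_E^ℓ ≤ K`** (explicit
format): see the module docstring. For `N = ⊤`, `ν = ℓ` this is `dictionaryStep_pow` (p497259); the new
monomial is `N' = σ^*N · 𝓘_{exc}^{ℓ-ν}`.
[cite: BierstoneGrigorievMilmanWlodarczyk2011, §3.2 Lemma 3.2.1] [cite: GortzWedhorn2020, Prop. 13.91 (1), Prop. 13.96 (2)]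
[cite: Kollar2007, (3.111) Step 3] [cite: Liu2002, Thm. 8.1.19 (a)] -/
theorem dictionaryStep_mixed {S : Type u} [CommRing S] [IsRegularLocalRing S] (I : Ideal S) {ℓ ν : ℕ}
    (hνℓ : ν ≤ ℓ)
    {E X : Scheme.{u}} (i : E ⟶ X) (g : X ⟶ Spec (.of S)) (𝔟 : E.IdealSheafData)
    [IsNoetherian X] (hX : Scheme.IsRegular X) (hE : Scheme.IsRegular E)
    [IsClosedImmersion i] (hiE : IsEffectiveCartier i.ker)
    (hEpt : ∀ e : E, g.base (i.base e) = IsLocalRing.closedPoint S)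
    (hg : ∃ K₀ : (Spec (.of S)).IdealSheafData, IsBlowup g K₀ ∧
      (K₀.support : Set (Spec (.of S))) ⊆ {IsLocalRing.closedPoint S})
    (M N K : X.IdealSheafData) (hM : IsEffectiveCartier M) (hN : IsEffectiveCartier N)
    (hNK : N * i.ker ^ ℓ ≤ K) (hKE : K.comap i = 𝔟)
    (hIMK : (affineBlowup.idealSheaf I).comap g = M * K)
    {E' : Scheme.{u}} (τ : E' ⟶ E) (C : E.IdealSheafData) (𝔟' : E'.IdealSheafData)
    (hC : Scheme.IsRegular C.subscheme) (hKC : K ≤ (C.map i) ^ ν) (hτ : IsBlowup τ C)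
    (hctrl : 𝔟.comap τ = C.comap τ ^ ν * 𝔟') :
    ∃ (X' : Scheme.{u}) (σ : X' ⟶ X) (hσ : IsBlowup σ (C.map i))
      (hτ' : IsBlowup τ ((C.map i).comap i)),
      IsNoetherian X' ∧ Scheme.IsRegular X' ∧ Scheme.IsRegular E' ∧
      IsClosedImmersion (hσ.strictTransformHom hτ') ∧
      IsEffectiveCartier (hσ.strictTransformHom hτ').ker ∧
      (C.map i).comap σ * (hσ.strictTransformHom hτ').ker = i.ker.comap σ ∧
      (∀ e : E', (σ ≫ g).base ((hσ.strictTransformHom hτ').base e) = IsLocalRing.closedPoint S) ∧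
      (∃ K' : (Spec (.of S)).IdealSheafData, IsBlowup (σ ≫ g) K' ∧
        (K'.support : Set (Spec (.of S))) ⊆ {IsLocalRing.closedPoint S}) ∧
      IsEffectiveCartier (M.comap σ * (C.map i).comap σ ^ ν) ∧
      IsEffectiveCartier (N.comap σ * (C.map i).comap σ ^ (ℓ - ν)) ∧
      (N.comap σ * (C.map i).comap σ ^ (ℓ - ν)) * (hσ.strictTransformHom hτ').ker ^ ℓ ≤
        controlledTransform σ (C.map i) K ν ∧
      (controlledTransform σ (C.map i) K ν).comap (hσ.strictTransformHom hτ') = 𝔟' ∧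
      (affineBlowup.idealSheaf I).comap (σ ≫ g) =
        (M.comap σ * (C.map i).comap σ ^ ν) * controlledTransform σ (C.map i) K ν := by
  -- the centre pushed into `X`
  set Ch : X.IdealSheafData := C.map i with hCh
  have hkerCh : i.ker ≤ Ch := ker_le_map_centre i C
  have hChE : Ch.comap i = C := comap_map_centre i C
  have hChreg : Scheme.IsRegular Ch.subscheme := isRegular_subscheme_map i C hC
  -- blow `X` up along `Ch`
  obtain ⟨X', σ, hσ⟩ := exists_isBlowup X Ch
  have hτ' : IsBlowup τ (Ch.comap i) := by rw [hChE]; exact hτ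
  refine ⟨X', σ, hσ, hτ', ?_⟩
  -- the strict-transform morphism
  set i' : E' ⟶ X' := hσ.strictTransformHom hτ' with hi'def
  have hsq : i' ≫ σ = τ ≫ i := hσ.strictTransformHom_comp hτ'
  haveI hi' : IsClosedImmersion i' := hσ.isClosedImmersion_of_comp_eq hτ' hsq
  -- `X'` is Noetherian and regular, `E'` is regular
  haveI : IsProper σ := hσ.isProper
  haveI : IsLocallyNoetherian X' := LocallyOfFiniteType.isLocallyNoetherian σ
  haveI : CompactSpace X' := QuasiCompact.compactSpace_of_compactSpace σ
  have hX'N : IsNoetherian X' := {}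
  have hX'reg : Scheme.IsRegular X' := hσ.isRegular_of_isRegular_subscheme hX hChreg
  haveI : IsLocallyNoetherian E := LocallyOfFiniteType.isLocallyNoetherian i
  have hE'reg : Scheme.IsRegular E' := hτ.isRegular_of_isRegular_subscheme hE hC
  -- the ideal of the strict transform
  have hker : i'.ker = controlledTransform σ Ch i.ker 1 :=
    hσ.ker_strictTransformHom_of_isRegular hX hChreg hτ' hkerCh (isRegular_subscheme_ker i hE)
  have hexc : IsEffectiveCartier (Ch.comap σ) := hσ.isEffectiveCartier
  have hkerfac : Ch.comap σ * i'.ker = i.ker.comap σ := by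
    rw [hker]; exact hσ.comap_mul_controlledTransform_one hkerCh
  have hkerE' : IsEffectiveCartier i'.ker := by
    have h2 : IsEffectiveCartier (i.ker.comap σ) := hiE.comap_of_isBlowup hσ
    rw [← hkerfac] at h2
    exact h2.of_mul_right
  -- the controlled transform with exponent `ν`
  have hKK' : Ch.comap σ ^ ν * controlledTransform σ Ch K ν = K.comap σ :=
    hσ.pow_mul_controlledTransform_eq (by
      rw [← comap_pow]; exact Scheme.IdealSheafData.comap_mono (f := σ) hKC)
  refine ⟨hX'N, hX'reg, hE'reg, hi', hkerE', hkerfac, ?_, ?_, (hM.comap_of_isBlowup hσ).mul (hexc.pow ν),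
    (hN.comap_of_isBlowup hσ).mul (hexc.pow (ℓ - ν)), ?_, ?_, ?_⟩
  · -- `E'` lies over the closed point
    intro e
    have : (i' ≫ σ).base e = (τ ≫ i).base e := by rw [hsq]
    simp only [Scheme.Hom.comp_base, TopCat.coe_comp, Function.comp_apply] at this ⊢
    rw [this]
    exact hEpt (τ.base e)
  · -- `σ ≫ g` is a blowing up cosupported in the closed point
    obtain ⟨K₀, hgK, hKsupp⟩ := hg
    have hChsupp : (Ch.support : Set X) ⊆ g.base ⁻¹' {IsLocalRing.closedPoint S} := by
      intro x hx
      obtain ⟨e, rfl⟩ := support_map_subset_range i C hx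
      exact hEpt e
    obtain ⟨Q, hQ, hQsupp⟩ := hgK.exists_isBlowup_comp_supported g K₀ σ Ch
      {IsLocalRing.closedPoint S} hKsupp hσ hChsupp
    exact ⟨Q, hQ, hQsupp⟩
  · -- MONOMIAL CONTACT `σ^*N · 𝓘_{exc}^{ℓ-ν} · 𝓘_{E'}^ℓ ≤ K'`: cancel `𝓘_{exc}^ν` in
    -- `𝓘_{exc}^ν · (σ^*N · 𝓘_{exc}^{ℓ-ν} · 𝓘_{E'}^ℓ) = σ^*N · (𝓘_{exc} 𝓘_{E'})^ℓ = σ^*(N · 𝓘_E^ℓ) ≤ σ^*K`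
    rw [controlledTransform, le_colon_iff]
    have hpow : Ch.comap σ ^ ν * (Ch.comap σ) ^ (ℓ - ν) = Ch.comap σ ^ ℓ := by
      rw [← pow_add, Nat.add_sub_cancel' hνℓ]
    calc Ch.comap σ ^ ν * (N.comap σ * Ch.comap σ ^ (ℓ - ν) * i'.ker ^ ℓ)
        = N.comap σ * ((Ch.comap σ ^ ν * Ch.comap σ ^ (ℓ - ν)) * i'.ker ^ ℓ) := by
          simp only [mul_left_comm, mul_assoc]
      _ = N.comap σ * (Ch.comap σ * i'.ker) ^ ℓ := by rw [hpow, mul_pow]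
      _ = (N * i.ker ^ ℓ).comap σ := by rw [hkerfac, comap_mul, comap_pow]
      _ ≤ K.comap σ := Scheme.IdealSheafData.comap_mono (f := σ) hNK
  · -- `K'|_{E'} = 𝔟'`: cancel the effective Cartier divisor `(C𝒪_{E'})^ν`
    apply (hτ.isEffectiveCartier.pow ν).eq_of_mul_eq_mul
    have h1 : (Ch.comap σ).comap i' = C.comap τ := by
      rw [← Scheme.IdealSheafData.comap_comp, hsq, Scheme.IdealSheafData.comap_comp, hChE]
    have h2 : (K.comap σ).comap i' = 𝔟.comap τ := by
      rw [← Scheme.IdealSheafData.comap_comp, hsq, Scheme.IdealSheafData.comap_comp, hKE]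
    rw [← hctrl, ← h2, ← hKK', comap_mul, comap_pow, h1]
  · -- `I𝒪_{X'} = σ^*M · 𝓘_{exc}^ν · K'`
    rw [Scheme.IdealSheafData.comap_comp, hIMK, comap_mul, ← hKK', mul_assoc]

/-- **D1^{ℓ,ν}, controlled-transform form**: as `dictionaryStep_mixed`, with the threefold side read off
rather than prescribed — `𝔟 := K|_E` and the new threefold ideal is the controlled transform
`τᶜ(K|_E, ν)` of exponent `ν` along the blowing up `τ` of `E` at `C`:
`K'|_{E'} = controlledTransform τ C (K.comap i) ν` (the weight-`ν` transport of the E-side datum of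
`IsWeightedSeq`). [cite: BierstoneGrigorievMilmanWlodarczyk2011, §3.2 Lemma 3.2.1]
[cite: GortzWedhorn2020, Prop. 13.91 (1), Prop. 13.96 (2)] -/
theorem dictionaryStep_mixed_controlledTransform {S : Type u} [CommRing S] [IsRegularLocalRing S]
    (I : Ideal S) {ℓ ν : ℕ} (hνℓ : ν ≤ ℓ)
    {E X : Scheme.{u}} (i : E ⟶ X) (g : X ⟶ Spec (.of S))
    [IsNoetherian X] (hX : Scheme.IsRegular X) (hE : Scheme.IsRegular E)
    [IsClosedImmersion i] (hiE : IsEffectiveCartier i.ker)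
    (hEpt : ∀ e : E, g.base (i.base e) = IsLocalRing.closedPoint S)
    (hg : ∃ K₀ : (Spec (.of S)).IdealSheafData, IsBlowup g K₀ ∧
      (K₀.support : Set (Spec (.of S))) ⊆ {IsLocalRing.closedPoint S})
    (M N K : X.IdealSheafData) (hM : IsEffectiveCartier M) (hN : IsEffectiveCartier N)
    (hNK : N * i.ker ^ ℓ ≤ K)
    (hIMK : (affineBlowup.idealSheaf I).comap g = M * K)
    {E' : Scheme.{u}} (τ : E' ⟶ E) (C : E.IdealSheafData)
    (hC : Scheme.IsRegular C.subscheme) (hKC : K ≤ (C.map i) ^ ν) (hτ : IsBlowup τ C) :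
    ∃ (X' : Scheme.{u}) (σ : X' ⟶ X) (hσ : IsBlowup σ (C.map i))
      (hτ' : IsBlowup τ ((C.map i).comap i)),
      IsNoetherian X' ∧ Scheme.IsRegular X' ∧ Scheme.IsRegular E' ∧
      IsClosedImmersion (hσ.strictTransformHom hτ') ∧
      IsEffectiveCartier (hσ.strictTransformHom hτ').ker ∧
      (C.map i).comap σ * (hσ.strictTransformHom hτ').ker = i.ker.comap σ ∧
      (∀ e : E', (σ ≫ g).base ((hσ.strictTransformHom hτ').base e) = IsLocalRing.closedPoint S) ∧
      (∃ K' : (Spec (.of S)).IdealSheafData, IsBlowup (σ ≫ g) K' ∧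
        (K'.support : Set (Spec (.of S))) ⊆ {IsLocalRing.closedPoint S}) ∧
      IsEffectiveCartier (M.comap σ * (C.map i).comap σ ^ ν) ∧
      IsEffectiveCartier (N.comap σ * (C.map i).comap σ ^ (ℓ - ν)) ∧
      (N.comap σ * (C.map i).comap σ ^ (ℓ - ν)) * (hσ.strictTransformHom hτ').ker ^ ℓ ≤
        controlledTransform σ (C.map i) K ν ∧
      (controlledTransform σ (C.map i) K ν).comap (hσ.strictTransformHom hτ') =
        controlledTransform τ C (K.comap i) ν ∧
      (affineBlowup.idealSheaf I).comap (σ ≫ g) =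
        (M.comap σ * (C.map i).comap σ ^ ν) * controlledTransform σ (C.map i) K ν := by
  -- the threefold side: `K|_E 𝒪_{E'} = (C𝒪_{E'})^ν · τᶜ(K|_E, ν)` (BGMW 3.2.1 with exponent `ν` on `E`)
  have hle : (K.comap i).comap τ ≤ C.comap τ ^ ν := by
    have h1 : K.comap i ≤ C ^ ν := by
      have h : K.comap i ≤ ((C.map i) ^ ν).comap i := Scheme.IdealSheafData.comap_mono (f := i) hKC
      rwa [comap_pow, comap_map_centre i C] at h
    have h : (K.comap i).comap τ ≤ (C ^ ν).comap τ := Scheme.IdealSheafData.comap_mono (f := τ) h1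
    rwa [comap_pow] at h
  have hctrl : (K.comap i).comap τ = C.comap τ ^ ν * controlledTransform τ C (K.comap i) ν :=
    (hτ.pow_mul_controlledTransform_eq hle).symm
  exact dictionaryStep_mixed I hνℓ i g (K.comap i) hX hE hiE hEpt hg M N K hM hN hNK rfl hIMK τ C
    (controlledTransform τ C (K.comap i) ν) hC hKC hτ hctrl

/-- **D1^{ℓ,1} — the WEIGHT-ONE step**: as `dictionaryStep_mixed_controlledTransform` with `ν = 1`
(`1 ≤ ℓ`), where the X-side permissibility `K ≤ C.map i` FOLLOWS from the E-side one `K|_E ≤ C` (the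
centre contains `𝓘_E = ker i`; `Scheme.IdealSheafData.le_map_iff_comap_le`), exactly as in D1: NO X-side
hypothesis. After the step the contact monomial is `N' = σ^*N · 𝓘_{exc}^{ℓ-1}` — for `ℓ = 2`, `N = ⊤`:
`𝓘_{exc} · 𝓘_{E'}² ≤ K'`, i.e. OFF the strict transform `E'` the residual has literal contact with the new
exceptional divisor (the «escaped depth-one sub-problem on the weight-1 carrier» of plan-1's KERNEL NOTE
v1.6). [cite: BierstoneGrigorievMilmanWlodarczyk2011, §3.2 Lemma 3.2.1]
[cite: GortzWedhorn2020, Prop. 13.91 (1), Prop. 13.96 (2)] -/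
theorem dictionaryStep_mixed_one {S : Type u} [CommRing S] [IsRegularLocalRing S]
    (I : Ideal S) {ℓ : ℕ} (hℓ : 1 ≤ ℓ)
    {E X : Scheme.{u}} (i : E ⟶ X) (g : X ⟶ Spec (.of S))
    [IsNoetherian X] (hX : Scheme.IsRegular X) (hE : Scheme.IsRegular E)
    [IsClosedImmersion i] (hiE : IsEffectiveCartier i.ker)
    (hEpt : ∀ e : E, g.base (i.base e) = IsLocalRing.closedPoint S)
    (hg : ∃ K₀ : (Spec (.of S)).IdealSheafData, IsBlowup g K₀ ∧
      (K₀.support : Set (Spec (.of S))) ⊆ {IsLocalRing.closedPoint S})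
    (M N K : X.IdealSheafData) (hM : IsEffectiveCartier M) (hN : IsEffectiveCartier N)
    (hNK : N * i.ker ^ ℓ ≤ K)
    (hIMK : (affineBlowup.idealSheaf I).comap g = M * K)
    {E' : Scheme.{u}} (τ : E' ⟶ E) (C : E.IdealSheafData)
    (hC : Scheme.IsRegular C.subscheme) (hKC : K.comap i ≤ C) (hτ : IsBlowup τ C) :
    ∃ (X' : Scheme.{u}) (σ : X' ⟶ X) (hσ : IsBlowup σ (C.map i))
      (hτ' : IsBlowup τ ((C.map i).comap i)),
      IsNoetherian X' ∧ Scheme.IsRegular X' ∧ Scheme.IsRegular E' ∧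
      IsClosedImmersion (hσ.strictTransformHom hτ') ∧
      IsEffectiveCartier (hσ.strictTransformHom hτ').ker ∧
      (C.map i).comap σ * (hσ.strictTransformHom hτ').ker = i.ker.comap σ ∧
      (∀ e : E', (σ ≫ g).base ((hσ.strictTransformHom hτ').base e) = IsLocalRing.closedPoint S) ∧
      (∃ K' : (Spec (.of S)).IdealSheafData, IsBlowup (σ ≫ g) K' ∧
        (K'.support : Set (Spec (.of S))) ⊆ {IsLocalRing.closedPoint S}) ∧
      IsEffectiveCartier (M.comap σ * (C.map i).comap σ ^ 1) ∧
      IsEffectiveCartier (N.comap σ * (C.map i).comap σ ^ (ℓ - 1)) ∧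
      (N.comap σ * (C.map i).comap σ ^ (ℓ - 1)) * (hσ.strictTransformHom hτ').ker ^ ℓ ≤
        controlledTransform σ (C.map i) K 1 ∧
      (controlledTransform σ (C.map i) K 1).comap (hσ.strictTransformHom hτ') =
        controlledTransform τ C (K.comap i) 1 ∧
      (affineBlowup.idealSheaf I).comap (σ ≫ g) =
        (M.comap σ * (C.map i).comap σ ^ 1) * controlledTransform σ (C.map i) K 1 := by
  have hKC' : K ≤ (C.map i) ^ 1 := by
    rw [pow_one, Scheme.IdealSheafData.le_map_iff_comap_le]
    exact hKC
  exact dictionaryStep_mixed_controlledTransform I hℓ i g hX hE hiE hEpt hg M N K hM hN hNK hIMK τ C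
    hC hKC' hτ

/-- **Mixed END, unit branch — where the residual ESCAPES to**: for a closed immersion `i : E ⟶ X`,
monomial contact `N · 𝓘_E^ℓ ≤ K` and `K|_E = ⊤` force `Supp K ⊆ Supp N` (`Supp K ⊆ Supp N ∪ E` and
`E ∩ Supp K = Supp (K|_E) = ∅`): once the E-side ideal is resolved, the cosupport of `K` lies on the
exceptional monomial `N` only (for `N = ⊤` this is the depth-`ℓ` END `eq_top_of_ker_pow_le_of_comap_eq_top`,
p498490). [cite: GortzWedhorn2020, (13.19) p. 414] -/
theorem support_subset_of_mul_ker_pow_le_of_comap_eq_top {E X : Scheme.{u}} (i : E ⟶ X)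
    [IsClosedImmersion i] {N K : X.IdealSheafData} {ℓ : ℕ}
    (hK : N * i.ker ^ ℓ ≤ K) (hKi : K.comap i = ⊤) : (K.support : Set X) ⊆ N.support := by
  intro x hx
  rcases Nat.eq_zero_or_pos ℓ with hℓ | hℓ
  · subst hℓ
    rw [pow_zero, mul_one] at hK
    exact Scheme.IdealSheafData.support_antitone hK hx
  have hx' : x ∈ ((N * i.ker ^ ℓ).support : Set X) := Scheme.IdealSheafData.support_antitone hK hx
  rw [Scheme.IdealSheafData.support_mul, TopologicalSpace.Closeds.coe_sup] at hx'
  rcases hx' with hxN | hxE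
  · exact hxN
  · exfalso
    rw [Scheme.IdealSheafData.support_pow _ _ hℓ.ne', Scheme.Hom.support_ker,
      i.isClosedEmbedding.isClosed_range.closure_eq] at hxE
    obtain ⟨e, rfl⟩ := hxE
    have he : e ∈ ((K.comap i).support : Set E) := by
      rw [Scheme.IdealSheafData.support_comap]
      exact hx
    rw [hKi, Scheme.IdealSheafData.support_top] at he
    exact he

/-- **Bookkeeping — the contact monomial stays over the closed point**: if `N` is cosupported over the
closed point of `Spec S` and `E` lies over it, then so is the new monomial `σ^*N · 𝓘_{exc}^k` of
`dictionaryStep_mixed` (its cosupport lies over `Supp N ∪ V(C.map i) ⊆ Supp N ∪ i(E)`); so the residual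
that escapes the strict transform of `E` escapes onto exceptional carriers over the closed point only.
[cite: GortzWedhorn2020, Prop. 13.91 (1)] -/
theorem monomial_support_over_closedPoint {S : Type u} [CommRing S] [IsLocalRing S]
    {E X X' : Scheme.{u}} (i : E ⟶ X) [IsClosedImmersion i] (g : X ⟶ Spec (.of S)) (σ : X' ⟶ X)
    (N : X.IdealSheafData) (C : E.IdealSheafData) (k : ℕ)
    (hNpt : ∀ x : X, x ∈ (N.support : Set X) → g.base x = IsLocalRing.closedPoint S)
    (hEpt : ∀ e : E, g.base (i.base e) = IsLocalRing.closedPoint S) :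
    ∀ x' : X', x' ∈ ((N.comap σ * (C.map i).comap σ ^ k).support : Set X') →
      (σ ≫ g).base x' = IsLocalRing.closedPoint S := by
  intro x' hx'
  simp only [Scheme.Hom.comp_base, TopCat.coe_comp, Function.comp_apply]
  rw [Scheme.IdealSheafData.support_mul, TopologicalSpace.Closeds.coe_sup] at hx'
  rcases hx' with hN | hC
  · rw [Scheme.IdealSheafData.support_comap] at hN
    exact hNpt _ hN
  · rcases Nat.eq_zero_or_pos k with hk | hk
    · subst hk
      rw [pow_zero, Scheme.IdealSheafData.one_eq_top, Scheme.IdealSheafData.support_top] at hC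
      exact absurd hC id
    · rw [Scheme.IdealSheafData.support_pow _ _ hk.ne', Scheme.IdealSheafData.support_comap] at hC
      obtain ⟨e, he⟩ := support_map_subset_range i C hC
      rw [← he]
      exact hEpt e

end DepthOne

end Summit.ResolutionOfSingularities.ResolutionOfSingularities.Theorems

end
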